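import Summits.Ventures.CertifiedManyBodySolver.Downfold.EmeryScaleRayCell
import HarnessLib

/-!
# THE RAY CELL WITH EXTERNAL ENERGY TRANSPORT: `T(A + s·d) ≤ (1 + s)·T(A)` (UPPER) / `(1 − s)·T(A) ≤ T(A + s·d)` (LOWER) at fixed filling over an
# anchor family, from the ray leaf and GIVEN two-sided bounds `E_A − ℓs ≤ E_M ≤ E_A + us` on the member's Fermi energy (INFL-3to1-B §B.91 (c′))

Venture CertifiedManyBodySolver, cell `pub/hubbard-downfold` (stage S1; INFLATION-RULES-3to1-B §B.91), seat hubbard-downfold-mod-4 (technique B = band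
level, g40); namespace `Summit.Ventures.CertifiedManyBodySolver.Downfold.Emery`. Everything PROVED (0 sorry). WHAT THIS IS NOT: a statement about any
material; no number lives here; `U = 0` one-body kinematics of the σ model.

WHY (successor of `EmeryScaleRayCell.rayCellCheck` in the same session). Along the oxygen-hopping ray `(t_pp, t_pp′) ↦ (1 + s)(t_pp, t_pp′)` the
contour-nesting transport of the member's Fermi energy is LOOSE (the antibonding band is motionless in `t_pp` at the antinode, scale-g36 LESSON 7, and the
hard leaf must hold down to a box-wide floor), while the CERTIFICATE-FREE bounds of `EmeryOxygenHoppingLipschitz` (`ε_F` non-decreasing and 4-Lipschitz in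
`t_pp`, non-increasing and 4-Lipschitz in `t_pp′`) give `E_A − 4cs ≤ E_M ≤ E_A + 4bs` at once. This file therefore checks ONLY the ray leaf (bisected) and
the regime scalars, and takes the energy enclosure as hypotheses; `EmeryScaleEdgeChainL` discharges them by the Lipschitz lemmas.

* **`rayCellCheckL`**; **`rayL_upper_cell`** (`T(M) ≤ (1 + s)·T(A)` given `E_A − ℓs ≤ E_M ≤ E_A + us`, rates `σp = −ℓ`, `σe = u`);
  **`rayL_lower_cell`** (`(1 − s)·T(A) ≤ T(M)` given `E_M ≤ E_A + us`, `σp = σe = u`).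

Sources: three-band model [HybertsenSchluterChristensen1989, Eq. (1)]; energy-linearised one-band image [AndersenEtAl1995, §6]; interval arithmetic
[folklore] (Moore 1966).
-/

noncomputable section

namespace Summit.Ventures.CertifiedManyBodySolver.Downfold.Emery

open Real Set Literature.Analysis.ValidatedNumerics.Numerics

/-- **`rayCellCheckL`**: bisection (depth `n`) of the ray leaf over the family box `F` (anchor `Δ, a, b`, step `s`, anchor window in the `e`-slot);
signs and regime at anchor and member, with the member's energy ceiling `W.hi + s·σe`; positivity of `W.lo + s·σp` and of `W.lo`. [folklore] -/
def rayCellCheckL (upper : Bool) (cd : RayCellData) (n : ℕ) (F : SBox) : Bool :=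
  let DM := F.iD.add (F.iS.mul cd.dD)
  let AM := F.iA.add (F.iS.mul cd.dA)
  let BM := F.iB.add (F.iS.mul cd.dB)
  let CM := cd.IC.add (F.iS.mul cd.dC)
  let etop : FI := (thin F.iE.hi).add (F.iS.mul cd.sgE)
  SBox.deep (rayPathLeaf upper cd) n F &&
  decide (0 < F.iD.lo) && decide (0 < F.iA.lo) && decide (0 ≤ F.iB.lo) && decide (0 ≤ cd.IC.lo) && decide (0 < DM.lo) && decide (0 < AM.lo) &&
  decide (0 ≤ BM.lo) && decide (0 ≤ CM.lo) && decide (0 ≤ (BM.sub CM).lo) && decide (0 ≤ F.iS.lo) &&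
  decide ((CM.mul etop).hi < (AM.sqr).lo) && decide ((BM.mul DM).hi < ((AM.sqr).mulInt 4).lo) &&
  decide (0 < ((thin F.iE.lo).add (F.iS.mul cd.sgP)).lo) && decide (0 < F.iE.lo)

section Cell

variable {cd : RayCellData} {dΔ da db dc c : ℝ} {n : ℕ} {F : SBox}

/-- The scalar part of `rayCellCheckL`, read in `ℝ`. [folklore] -/
theorem rayCellCheckL_scalars {upper : Bool} {σe σh σp : ℝ} (hcd : (FI.mem dΔ cd.dD ∧ FI.mem da cd.dA ∧ FI.mem db cd.dB ∧ FI.mem dc cd.dC ∧ FI.mem c cd.IC ∧ FI.mem σe cd.sgE ∧ FI.mem σh cd.sgH ∧ FI.mem σp cd.sgP))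
    (h : rayCellCheckL upper cd n F = true) {Δ a b s : ℝ} (hD : FI.mem Δ F.iD) (hA : FI.mem a F.iA) (hB : FI.mem b F.iB) (hS : FI.mem s F.iS) :
    SBox.deep (rayPathLeaf upper cd) n F = true ∧
    0 < Δ ∧ 0 < a ∧ 0 ≤ b ∧ 0 ≤ c ∧ 0 < Δ + s * dΔ ∧ 0 < a + s * da ∧ 0 ≤ b + s * db ∧ 0 ≤ c + s * dc ∧ c + s * dc ≤ b + s * db ∧ 0 ≤ s ∧
    (c + s * dc) * ((F.iE.hi : ℝ) / SC + s * σe) < (a + s * da) ^ 2 ∧ (b + s * db) * (Δ + s * dΔ) < 4 * (a + s * da) ^ 2 ∧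
    0 < (F.iE.lo : ℝ) / SC + s * σp ∧ 0 < (F.iE.lo : ℝ) / SC := by
  obtain ⟨g1, g2, g3, g4, g5, g6, g7, g8⟩ := hcd
  unfold rayCellCheckL at h
  simp only [Bool.and_eq_true, decide_eq_true_eq] at h
  obtain ⟨⟨⟨⟨⟨⟨⟨⟨⟨⟨⟨⟨⟨⟨hpath, hD0⟩, hA0⟩, hB0⟩, hC0⟩, hDM⟩, hAM⟩, hBM⟩, hCM⟩, hBMc⟩, hs0⟩, hregm⟩, hregq⟩, hpos1⟩, hlo0⟩ := h
  have mDM := FI.mem_add hD (FI.mem_mul hS g1)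
  have mAM := FI.mem_add hA (FI.mem_mul hS g2)
  have mBM := FI.mem_add hB (FI.mem_mul hS g3)
  have mCM := FI.mem_add g5 (FI.mem_mul hS g4)
  have mlo : FI.mem ((F.iE.lo : ℝ) / SC) (thin F.iE.lo) := mem_thin _
  have mhi : FI.mem ((F.iE.hi : ℝ) / SC) (thin F.iE.hi) := mem_thin _
  refine ⟨hpath, FI.pos_of_lo_pos hD hD0, FI.pos_of_lo_pos hA hA0, nonneg_of_lo_nonneg hB hB0, nonneg_of_lo_nonneg g5 hC0,
    FI.pos_of_lo_pos mDM hDM, FI.pos_of_lo_pos mAM hAM, nonneg_of_lo_nonneg mBM hBM, nonneg_of_lo_nonneg mCM hCM, ?_, nonneg_of_lo_nonneg hS hs0,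
    ?_, ?_, ?_, div_pos (by exact_mod_cast hlo0) SC_pos⟩
  · have := nonneg_of_lo_nonneg (FI.mem_sub mBM mCM) hBMc; linarith
  · exact FI.lt_of_hi_lt_lo (FI.mem_mul mCM (FI.mem_add mhi (FI.mem_mul hS g6))) (FI.mem_sqr mAM) hregm
  · have := FI.lt_of_hi_lt_lo (FI.mem_mul mBM mDM) (FI.mem_mulInt (FI.mem_sqr mAM) 4) hregq
    push_cast at this; linarith
  · exact FI.pos_of_lo_pos (FI.mem_add mlo (FI.mem_mul hS g8)) hpos1

/-- **THE UPPER RAY CELL (external energy transport).** `rayCellCheckL true` with rates `σe = u`, `σp = −ℓ`: for every anchor `A = (Δ, a, b, c)` of the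
family and every step `s` of the cell, IF `ε_F(A) ∈ W` and `ε_F(A) − ℓs ≤ ε_F(M) ≤ ε_F(A) + us` (member `M = A + s·d`), THEN
**`T(M) ≤ (1 + s)·T(A)`**. [folklore] -/
theorem rayL_upper_cell {u σh ℓ ν : ℝ} (hcd : (FI.mem dΔ cd.dD ∧ FI.mem da cd.dA ∧ FI.mem db cd.dB ∧ FI.mem dc cd.dC ∧ FI.mem c cd.IC ∧ FI.mem u cd.sgE ∧ FI.mem σh cd.sgH ∧ FI.mem (-ℓ) cd.sgP)) (h : rayCellCheckL true cd n F = true)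
    {Δ a b s : ℝ} (hD : FI.mem Δ F.iD) (hA : FI.mem a F.iA) (hB : FI.mem b F.iB) (hS : FI.mem s F.iS)
    (hW : FI.mem (fermiEnergyOf Δ a b c ν) F.iE)
    (hlo : fermiEnergyOf Δ a b c ν - ℓ * s ≤ fermiEnergyOf (Δ + s * dΔ) (a + s * da) (b + s * db) (c + s * dc) ν)
    (hhi : fermiEnergyOf (Δ + s * dΔ) (a + s * da) (b + s * db) (c + s * dc) ν ≤ fermiEnergyOf Δ a b c ν + u * s) :
    scaleNodeN (Δ + s * dΔ) (a + s * da) (b + s * db) (c + s * dc) (fermiEnergyOf (Δ + s * dΔ) (a + s * da) (b + s * db) (c + s * dc) ν) /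
        scaleNodeD (Δ + s * dΔ) (a + s * da) (b + s * db) (c + s * dc) (fermiEnergyOf (Δ + s * dΔ) (a + s * da) (b + s * db) (c + s * dc) ν) ≤
      (1 + s) * (scaleNodeN Δ a b c (fermiEnergyOf Δ a b c ν) / scaleNodeD Δ a b c (fermiEnergyOf Δ a b c ν)) := by
  obtain ⟨hpath, HD, HA, HB, HC, HDM, HAM, HBM, HCM, HCMBM, Hs, Hregm, Hregq, Hpos1, Hlo⟩ := rayCellCheckL_scalars hcd h hD hA hB hS
  set EA := fermiEnergyOf Δ a b c ν with hEA
  set EM := fermiEnergyOf (Δ + s * dΔ) (a + s * da) (b + s * db) (c + s * dc) ν with hEM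
  have hWI := mem_Icc_of_fimem hW
  have h1 : 0 < EA - ℓ * s := by have := hWI.1; nlinarith
  have hm : (c + s * dc) * EM < (a + s * da) ^ 2 := by
    have : EM ≤ (F.iE.hi : ℝ) / SC + s * u := by have := hWI.2; linarith
    exact lt_of_le_of_lt (mul_le_mul_of_nonneg_left this HCM) Hregm
  have hanti := scaleNode_div_antitone HDM HCM HCMBM HAM.ne' h1 hlo hm Hregq
  have hray := SBox.forall_of_deep (rayPathLeaf_upper_sound hcd) n F hpath Δ a b s EA ⟨hD, hA, hB, hS, hW⟩
  have e1 : EA + s * -ℓ = EA - ℓ * s := by ring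
  rw [e1] at hray
  exact hanti.trans hray

/-- **THE LOWER RAY CELL (external energy transport).** `rayCellCheckL false` with rates `σe = σp = u`: for every anchor `A` of the family and every
step `s` of the cell, IF `ε_F(A) ∈ W` and `ε_F(M) ≤ ε_F(A) + us`, THEN **`(1 − s)·T(A) ≤ T(M)`**. [folklore] -/
theorem rayL_lower_cell {u σh ν : ℝ} (hcd : (FI.mem dΔ cd.dD ∧ FI.mem da cd.dA ∧ FI.mem db cd.dB ∧ FI.mem dc cd.dC ∧ FI.mem c cd.IC ∧ FI.mem u cd.sgE ∧ FI.mem σh cd.sgH ∧ FI.mem u cd.sgP)) (hν0 : 0 < ν) (hν1 : ν < 1) (h : rayCellCheckL false cd n F = true)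
    {Δ a b s : ℝ} (hD : FI.mem Δ F.iD) (hA : FI.mem a F.iA) (hB : FI.mem b F.iB) (hS : FI.mem s F.iS)
    (hW : FI.mem (fermiEnergyOf Δ a b c ν) F.iE)
    (hhi : fermiEnergyOf (Δ + s * dΔ) (a + s * da) (b + s * db) (c + s * dc) ν ≤ fermiEnergyOf Δ a b c ν + u * s) :
    (1 - s) * (scaleNodeN Δ a b c (fermiEnergyOf Δ a b c ν) / scaleNodeD Δ a b c (fermiEnergyOf Δ a b c ν)) ≤
      scaleNodeN (Δ + s * dΔ) (a + s * da) (b + s * db) (c + s * dc) (fermiEnergyOf (Δ + s * dΔ) (a + s * da) (b + s * db) (c + s * dc) ν) /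
        scaleNodeD (Δ + s * dΔ) (a + s * da) (b + s * db) (c + s * dc) (fermiEnergyOf (Δ + s * dΔ) (a + s * da) (b + s * db) (c + s * dc) ν) := by
  obtain ⟨hpath, HD, HA, HB, HC, HDM, HAM, HBM, HCM, HCMBM, Hs, Hregm, Hregq, Hpos1, Hlo⟩ := rayCellCheckL_scalars hcd h hD hA hB hS
  set EA := fermiEnergyOf Δ a b c ν with hEA
  set EM := fermiEnergyOf (Δ + s * dΔ) (a + s * da) (b + s * db) (c + s * dc) ν with hEM
  have hWI := mem_Icc_of_fimem hW
  have hEM0 : 0 < EM := fermiEnergyOf_pos HDM HAM.ne' HCM HBM hν0 hν1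
  have hm : (c + s * dc) * (EA + u * s) < (a + s * da) ^ 2 := by
    have : EA + u * s ≤ (F.iE.hi : ℝ) / SC + s * u := by have := hWI.2; linarith
    exact lt_of_le_of_lt (mul_le_mul_of_nonneg_left this HCM) Hregm
  have hanti := scaleNode_div_antitone HDM HCM HCMBM HAM.ne' hEM0 hhi hm Hregq
  have hray := SBox.forall_of_deep (rayPathLeaf_lower_sound hcd) n F hpath Δ a b s EA ⟨hD, hA, hB, hS, hW⟩
  have e1 : EA + s * u = EA + u * s := by ring
  rw [e1] at hray
  exact hray.trans hanti

end Cell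

end Summit.Ventures.CertifiedManyBodySolver.Downfold.Emery
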